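import Literature.NumberTheory.GelbartRogawski1991.LocalUnitarySplittingDatum
import Literature.RepresentationTheory.HeisenbergGroup.MpPsiIntertwinerCongr
import Literature.RepresentationTheory.HeisenbergGroup.ImplementerTransport
import Literature.RepresentationTheory.HeisenbergGroup.SchrodingerSymplecticGenerators
import Literature.NumberTheory.Automorphic.UnitaryGroupFormTransport
import Literature.NumberTheory.Automorphic.UnitaryGroupFinAdelicCenterLocal
import Literature.NumberTheory.Automorphic.SmoothRepresentation
import HarnessLib

-- buildfix G11b-3 recipe (as in the GelbartRogawski1991 siblings): sequential elaboration.
set_option Elab.async false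

/-!
# Transport of the local rank-one theta currency along a RATIONAL change of frame `T ↦ Pᵀ T P`

Topic `NumberTheory/GelbartRogawski1991`; namespace `Literature.NumberTheory.GelbartRogawski1991.UnitaryDualPair.LocalSplitting.FrameTransport`.
KERNEL MATHEMATICS ONLY: definitions with bodies + theorems; no named fact, no `sorry`.

Setting: `E/F` quadratic with `c`, `δ`, `d`; two symmetric Gram matrices `T, T' ∈ M_N(F)` related by a RATIONAL change of
frame `P ∈ GL_N(F)`, `Pᵀ T P = T'`; `J = T ⊗ 1`, `J' = T' ⊗ 1`; a finite place `v`.  Everything the rank-one theta rows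
(`RankOneThetaLift*.lean`) are stated in moves along `P`:

* §1 (unitary side) **`frameConj : U(J')(F_v) ≃ₜ* U(J)(F_v)`**, `g' ↦ P g' P⁻¹` (the tree's `unitaryGroupOfFormCongrOfEq`
  at the local form matrices, `formCongr_localForm`), on `localPi` via `localPiEquiv`; it fixes the centre
  (`frameConj_localCenter`);
* §2 (symplectic side) `frameW : 𝕎_v ≃ 𝕎_v`, `(x, y) ↦ (P x, P y)`, with `β_T(P x, P y') = β_{T'}(x, y')`
  (`polar_frameW`); hence `Heisenberg.mapEquiv frameW : H(𝕎_{T'}) ≃* H(𝕎_T)`, `symplecticConj frameW : Sp(𝕎_{T'}) ≃*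
  Sp(𝕎_T)`, and **`iota_frameConj : ι_T (P g' P⁻¹) = frameW ∘ ι_{T'}(g') ∘ frameW⁻¹`**;
* §3 (the models) the Levi-type operator `frameOp : 𝒮(F_vᴺ) ≃ 𝒮(F_vᴺ)`, `f ↦ f ∘ P⁻¹` (tree `leviEquivSB`), INTERTWINES
  the Schrödinger models: `frameOp (ρ_{T'}(h) f) = ρ_T(mapEquiv h) (frameOp f)` (`frameOp_schrodinger`); so
  `MpPsi.congr` (tree `MpPsiIntertwinerCongr`) gives **`frameMp : S̃p(𝕎_{T'}) ≃* S̃p(𝕎_T)`** over `symplecticConj frameW`;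
* §4 (sections) for `s : U(J)(F_v) →* S̃p(𝕎_T)` over `ι_T`: **`frameSection s := frameMp⁻¹ ∘ s ∘ frameConj`** is a
  homomorphism `U(J')(F_v) →* S̃p(𝕎_{T'})` OVER `ι_{T'}` (`proj_frameSection`), with
  `ω_{frameSection s}(g') = frameOp⁻¹ ∘ ω_s(P g' P⁻¹) ∘ frameOp` (`toRep_frameSection_apply`) and smooth when `ω_s` is
  (`isSmooth_frameSection`).

[MoeglinVignerasWaldspurger1987, Chap. 2 II Remarque (3)]: `GSp(W)` (here an isometry between two symplectic forms on
the same `F_v`-space) acts by transport of structure on `H` and `S̃p_ψ(W)`; [Weil1964, n° 34] «changement de base».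
Consumer: the route-R reduction of row IV-4c3 (`rankOne_theta_twist_rigidity`) from a general symmetric `T` to a
block-diagonal frame.  HC_CM is NOT proved here.

## References
* [MoeglinVignerasWaldspurger1987] LNM 1291 (1987), Chap. 2 I.7, II.1, II Remarques (2)–(3).
* [Weil1964] A. Weil, Acta Math. 111 (1964), n° 5, n° 34.
* [PlatonovRapinchuk1994] V. Platonov, A. Rapinchuk, *Algebraic Groups and Number Theory*, §2.3 (conjugate unitary groups).
-/

set_option autoImplicit false

noncomputable section

open NumberField IsDedekindDomain Matrix
open scoped MatrixGroups
open Literature.RepresentationTheory.HeisenbergGroup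
open Literature.NumberTheory.Automorphic

namespace Literature.RepresentationTheory.HeisenbergGroup

section FrameGeneric

variable {K : Type*} [CommRing K] {X : Type*} [AddCommGroup X] [Module K X]
  (β β' : X →ₗ[K] X →ₗ[K] K) (ψ : AddChar K Circle) (a : X ≃ₗ[K] X) (hβ : ∀ x y, β (a x) (a y) = β' x y)

include hβ in
/-- `polar β ((a × a) v) ((a × a) w) = polar β' v w` when `β (a x) (a y) = β' x y`. [cite: Weil1964, n° 34] -/
theorem polar_prodCongr (v w : X × X) : polar β (a.prodCongr a v) (a.prodCongr a w) = polar β' v w := by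
  rw [polar_apply, polar_apply, LinearEquiv.prodCongr_apply, LinearEquiv.prodCongr_apply]
  exact hβ v.1 w.2

/-- **the Levi-type operator `φ ↦ φ ∘ a⁻¹` intertwines the Schrödinger models of `β'` and `β`** along the Heisenberg
isomorphism `((x, y), t) ↦ ((a x, a y), t)` (`β (a x) (a y) = β' x y`): `(ρ_{β'}(h) φ) ∘ a⁻¹ = ρ_β((a × a) h) (φ ∘ a⁻¹)`.
[cite: MoeglinVignerasWaldspurger1987, Chap. 2 I.7; Weil1964, n° 34] -/
theorem leviOp_schrodinger (h : Heisenberg (polar β')) (φ : X → ℂ) :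
    leviOp a (schrodinger β' ψ h φ) =
      schrodinger β ψ (Heisenberg.mapEquiv (a.prodCongr a) (polar_prodCongr β β' a hβ) h) (leviOp a φ) := by
  funext u
  rw [leviOp_apply, schrodinger_apply, schrodinger_apply, leviOp_apply]
  change ((ψ (h.t + β' (a.symm u) h.v.2) : Circle) : ℂ) * φ (a.symm u + h.v.1) =
    ((ψ (h.t + β u (a h.v.2)) : Circle) : ℂ) * φ (a.symm (u + a h.v.1))
  rw [LinearEquiv.map_add, LinearEquiv.symm_apply_apply, ← hβ (a.symm u) h.v.2, LinearEquiv.apply_symm_apply]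

end FrameGeneric

end Literature.RepresentationTheory.HeisenbergGroup

namespace Literature.NumberTheory.GelbartRogawski1991.UnitaryDualPair.LocalSplitting

namespace FrameTransport

variable (F : Type) [Field F] [NumberField F] (E : Type) [Field E] [NumberField E] [Algebra F E] (c : E ≃ₐ[F] E)
  (v : HeightOneSpectrum (𝓞 F)) (N : ℕ) {T T' : Matrix (Fin N) (Fin N) F}
  {J : Matrix (Fin N) (Fin N) E} (hJ : J = T.map (algebraMap F E))
  {J' : Matrix (Fin N) (Fin N) E} (hJ' : J' = T'.map (algebraMap F E))
  (P : GL (Fin N) F) (hP : (P : Matrix (Fin N) (Fin N) F)ᵀ * T * (P : Matrix (Fin N) (Fin N) F) = T')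

local notation "Fv" => v.adicCompletion F

/-! ## §1 The unitary side: `g' ↦ P g' P⁻¹` -/

/-- `P` read in `GL_N(E ⊗_F F_v)`. [cite: PlatonovRapinchuk1994, §2.3] -/
def framePloc : GL (Fin N) (UnitaryGroup.LocalRing E v) :=
  Units.map ((UnitaryGroup.toLocalRing E v).comp (algebraMap F Fv)).mapMatrix.toMonoidHom P

/-- matrix of `framePloc`. [cite: PlatonovRapinchuk1994, §2.3] -/
@[simp] theorem coe_framePloc :
    (framePloc F E v N P).1 = (P : Matrix (Fin N) (Fin N) F).map ((UnitaryGroup.toLocalRing E v).comp (algebraMap F Fv)) := rfl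

/-- `framePloc` is fixed by `c ⊗ 1`. [cite: PlatonovRapinchuk1994, §2.3] -/
theorem framePloc_map_conjLocal :
    (framePloc F E v N P).1.map (UnitaryGroup.conjLocal E c v) = (framePloc F E v N P).1 := by
  rw [coe_framePloc]
  ext i j
  simp only [Matrix.map_apply, RingHom.comp_apply, UnitaryGroup.conjLocal_toLocalRing]

include hJ hJ' hP in
/-- **`(P ⊗ 1)ᵀ (T ⊗ 1) (P ⊗ 1) = T' ⊗ 1`** at the local form matrices of `U(J)(F_v)`, `U(J')(F_v)`.
[cite: PlatonovRapinchuk1994, §2.3] -/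
theorem formCongr_localForm :
    formCongr (UnitaryGroup.conjLocal E c v) (framePloc F E v N P) ((UnitaryGroup.adelicForm E N J).map (UnitaryGroup.adeleToLocal E v)) =
      (UnitaryGroup.adelicForm E N J').map (UnitaryGroup.adeleToLocal E v) := by
  rw [formCongr, framePloc_map_conjLocal, UnitaryGroup.localForm_eq_map E N v T hJ, UnitaryGroup.localForm_eq_map E N v T' hJ',
    coe_framePloc, Matrix.map_map, Matrix.map_map, ← RingHom.coe_comp, ← Matrix.transpose_map, ← Matrix.map_mul,
    ← Matrix.map_mul, hP]

/-- **`U(J')(F_v) ≃ₜ* U(J)(F_v)`, `g' ↦ P g' P⁻¹`**, on the matrix forms. [cite: PlatonovRapinchuk1994, §2.3] -/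
def frameConjLocal : UnitaryGroup.«local» E c N J' v ≃ₜ* UnitaryGroup.«local» E c N J v :=
  unitaryGroupOfFormCongrOfEq (UnitaryGroup.conjLocal E c v) (framePloc F E v N P) _ _ (formCongr_localForm F E c v N hJ hJ' P hP)

/-- matrix of `frameConjLocal g'`: `P g' P⁻¹`. [cite: PlatonovRapinchuk1994, §2.3] -/
@[simp] theorem coe_frameConjLocal (g' : UnitaryGroup.«local» E c N J' v) :
    ((frameConjLocal F E c v N hJ hJ' P hP g' : UnitaryGroup.«local» E c N J v) : GL (Fin N) (UnitaryGroup.LocalRing E v)) =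
      framePloc F E v N P * (g' : GL (Fin N) (UnitaryGroup.LocalRing E v)) * (framePloc F E v N P)⁻¹ := rfl

/-- **`U(J')(F_v) ≃ₜ* U(J)(F_v)`, `g' ↦ P g' P⁻¹`**, on the factor forms `localPi`. [cite: PlatonovRapinchuk1994, §2.3] -/
def frameConj : UnitaryGroup.localPi E c N J' v ≃ₜ* UnitaryGroup.localPi E c N J v :=
  ((UnitaryGroup.localPiEquiv E c N J' v).trans (frameConjLocal F E c v N hJ hJ' P hP)).trans
    (UnitaryGroup.localPiEquiv E c N J v).symm

/-- unfolding: `localPiEquiv (frameConj g') = frameConjLocal (localPiEquiv g')`. [cite: PlatonovRapinchuk1994, §2.3] -/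
theorem localPiEquiv_frameConj (g' : UnitaryGroup.localPi E c N J' v) :
    UnitaryGroup.localPiEquiv E c N J v (frameConj F E c v N hJ hJ' P hP g') =
      frameConjLocal F E c v N hJ hJ' P hP (UnitaryGroup.localPiEquiv E c N J' v g') :=
  (UnitaryGroup.localPiEquiv E c N J v).apply_symm_apply _

/-! ## §2 The symplectic side: `(x, y) ↦ (P x, P y)` -/

/-- `P` read in `GL_N(F_v)`. [cite: Weil1964, n° 34] -/
def framePv : GL (Fin N) Fv := Units.map (RingHom.mapMatrix (algebraMap F Fv)).toMonoidHom P

/-- matrix of `framePv`. [cite: Weil1964, n° 34] -/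
@[simp] theorem coe_framePv : ((framePv F v N P : GL (Fin N) Fv) : Matrix (Fin N) (Fin N) Fv) =
    (P : Matrix (Fin N) (Fin N) F).map (algebraMap F Fv) := rfl

/-- `x ↦ P x` as a linear automorphism of `F_vᴺ`. [cite: Weil1964, n° 34] -/
def frameLin : (Fin N → Fv) ≃ₗ[Fv] (Fin N → Fv) where
  toFun x := (framePv F v N P).1 *ᵥ x
  invFun x := ((framePv F v N P)⁻¹ : GL (Fin N) Fv).1 *ᵥ x
  map_add' x y := Matrix.mulVec_add _ x y
  map_smul' a x := Matrix.mulVec_smul _ a x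
  left_inv x := by
    change ((framePv F v N P)⁻¹ : GL (Fin N) Fv).1 *ᵥ ((framePv F v N P).1 *ᵥ x) = x
    rw [Matrix.mulVec_mulVec, ← Units.val_mul, inv_mul_cancel, Units.val_one, Matrix.one_mulVec]
  right_inv x := by
    change (framePv F v N P).1 *ᵥ (((framePv F v N P)⁻¹ : GL (Fin N) Fv).1 *ᵥ x) = x
    rw [Matrix.mulVec_mulVec, ← Units.val_mul, mul_inv_cancel, Units.val_one, Matrix.one_mulVec]

/-- formula: `frameLin x = P x`. [cite: Weil1964, n° 34] -/
@[simp] theorem frameLin_apply (x : Fin N → Fv) :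
    frameLin F v N P x = ((P : Matrix (Fin N) (Fin N) F).map (algebraMap F Fv)) *ᵥ x := rfl

/-- formula: `frameLin⁻¹ x = P⁻¹ x`. [cite: Weil1964, n° 34] -/
theorem frameLin_symm_apply (x : Fin N → Fv) :
    (frameLin F v N P).symm x = ((framePv F v N P)⁻¹ : GL (Fin N) Fv).1 *ᵥ x := rfl

/-- `frameLin` is continuous. [cite: Weil1964, n° 34] -/
theorem continuous_frameLin : Continuous (frameLin F v N P) :=
  ((frameLin F v N P : (Fin N → Fv) ≃ₗ[Fv] (Fin N → Fv)) : (Fin N → Fv) →ₗ[Fv] (Fin N → Fv)).continuous_on_pi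

/-- `frameLin⁻¹` is continuous. [cite: Weil1964, n° 34] -/
theorem continuous_frameLin_symm : Continuous (frameLin F v N P).symm :=
  (((frameLin F v N P).symm : (Fin N → Fv) ≃ₗ[Fv] (Fin N → Fv)) : (Fin N → Fv) →ₗ[Fv] (Fin N → Fv)).continuous_on_pi

/-- **`frameW : 𝕎_v ≃ 𝕎_v`, `(x, y) ↦ (P x, P y)`.** [cite: Weil1964, n° 34] -/
def frameW : ((Fin N → Fv) × (Fin N → Fv)) ≃ₗ[Fv] ((Fin N → Fv) × (Fin N → Fv)) :=
  (frameLin F v N P).prodCongr (frameLin F v N P)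

/-- formula. [cite: Weil1964, n° 34] -/
@[simp] theorem frameW_apply (w : (Fin N → Fv) × (Fin N → Fv)) :
    frameW F v N P w = (frameLin F v N P w.1, frameLin F v N P w.2) := rfl

include hP in
/-- **`β_T(P x, P y) = β_{T'}(x, y)`** (`Pᵀ T P = T'` read over `F_v`). [cite: Weil1964, n° 34] -/
theorem localPairing_frameLin (x y : Fin N → Fv) :
    localPairing F N T v (frameLin F v N P x) (frameLin F v N P y) = localPairing F N T' v x y := by
  have hP' : ((P : Matrix (Fin N) (Fin N) F).map (algebraMap F Fv))ᵀ * localGram F N T v *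
      (P : Matrix (Fin N) (Fin N) F).map (algebraMap F Fv) = localGram F N T' v := by
    rw [localGram, localGram, ← hP, Matrix.map_mul, Matrix.map_mul, Matrix.transpose_map]
  rw [localPairing, localPairing, Matrix.toLinearMap₂'_apply', Matrix.toLinearMap₂'_apply', frameLin_apply, frameLin_apply,
    ← hP', ← Matrix.mulVec_mulVec, ← Matrix.mulVec_mulVec, Matrix.dotProduct_mulVec x, Matrix.vecMul_transpose]

include hP in
/-- `polar β_T (frameW w) (frameW w') = polar β_{T'} w w'`. [cite: Weil1964, n° 34] -/
theorem polar_frameW (w w' : (Fin N → Fv) × (Fin N → Fv)) :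
    polar (localPairing F N T v) (frameW F v N P w) (frameW F v N P w') = polar (localPairing F N T' v) w w' :=
  polar_prodCongr (localPairing F N T v) (localPairing F N T' v) (frameLin F v N P) (localPairing_frameLin F v N P hP) w w'

/-- **the symplectic isomorphism `Sp(𝕎_{T'}) ≃* Sp(𝕎_T)`, `g ↦ frameW g frameW⁻¹`.** [cite: Weil1964, n° 34] -/
def frameSp : LocalSp F N T' v ≃* LocalSp F N T v :=
  symplecticConj (frameW F v N P) (polar_frameW F v N P hP)

/-- **the Heisenberg isomorphism `H(𝕎_{T'}) ≃* H(𝕎_T)`, `(w, t) ↦ (frameW w, t)`.** [cite: Weil1964, n° 5] -/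
def frameH : Heisenberg (polar (localPairing F N T' v)) ≃* Heisenberg (polar (localPairing F N T v)) :=
  Heisenberg.mapEquiv (frameW F v N P) (polar_frameW F v N P hP)

/-- Weil's sections are compatible with the transport (tree `ofSymplectic_symplecticConj_act`).
[cite: Weil1964, n° 5, pp. 150–151] -/
theorem frameH_act (g : LocalSp F N T' v) (h : Heisenberg (polar (localPairing F N T' v))) :
    frameH F v N P hP ((ofSymplectic _ g).act h) = (ofSymplectic _ (frameSp F v N P hP g)).act (frameH F v N P hP h) :=
  (ofSymplectic_symplecticConj_act (frameW F v N P) (polar_frameW F v N P hP) g h).symm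

/-! ## §3 The models: `frameOp f = f ∘ P⁻¹` intertwines `ρ_{T'}` with `ρ_T ∘ frameH` -/

/-- **the frame operator `f ↦ f ∘ P⁻¹` on `𝒮(F_vᴺ)`** (tree `leviEquivSB`). [cite: Weil1964, n° 13, p. 160] -/
def frameOp : SchwartzBruhat (Fin N → Fv) ≃ₗ[ℂ] SchwartzBruhat (Fin N → Fv) :=
  leviEquivSB (frameLin F v N P) (continuous_frameLin F v N P) (continuous_frameLin_symm F v N P)

/-- formula: `(frameOp f) u = f (P⁻¹ u)`. [cite: Weil1964, n° 13, p. 160] -/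
@[simp] theorem coe_frameOp_apply (f : SchwartzBruhat (Fin N → Fv)) (u : Fin N → Fv) :
    ((frameOp F v N P f : SchwartzBruhat (Fin N → Fv)) : (Fin N → Fv) → ℂ) u = (f : (Fin N → Fv) → ℂ) ((frameLin F v N P).symm u) := by
  rw [frameOp, coe_leviEquivSB, leviOp_apply]

/-- **`frameOp` intertwines the Schrödinger models**: `frameOp (ρ_{T'}(h) f) = ρ_T(frameH h) (frameOp f)`
(the generic `leviOp_schrodinger`: `β_T(u, P y) = β_{T'}(P⁻¹ u, y)` and `P⁻¹(u + P x) = P⁻¹ u + x`).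
[cite: MoeglinVignerasWaldspurger1987, Chap. 2 I.7] -/
theorem frameOp_schrodinger (h : Heisenberg (polar (localPairing F N T' v))) (f : SchwartzBruhat (Fin N → Fv)) :
    frameOp F v N P (localSchrodinger F N T' v h f) = localSchrodinger F N T v (frameH F v N P hP h) (frameOp F v N P f) :=
  Subtype.ext (leviOp_schrodinger (localPairing F N T v) (localPairing F N T' v) (adeleAddCharAt F v) (frameLin F v N P)
    (localPairing_frameLin F v N P hP) h (f : (Fin N → Fv) → ℂ))

/-- **`frameMp : S̃p(𝕎_{T'}) ≃* S̃p(𝕎_T)` over `frameSp`**, `(g, M) ↦ (frameSp g, frameOp M frameOp⁻¹)` (tree `MpPsi.congr`).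
[cite: MoeglinVignerasWaldspurger1987, Chap. 2 II Remarque (3)] -/
def frameMp : LocalMp F N T' v ≃* LocalMp F N T v :=
  MpPsi.congr (localSchrodinger F N T' v) (localSchrodinger F N T v) (Φ := frameH F v N P hP) (T := frameOp F v N P)
    (φ := frameSp F v N P hP) (frameOp_schrodinger F v N P hP) (fun g h => frameH_act F v N P hP g h)

/-- `frameMp` lies over `frameSp`. [cite: MoeglinVignerasWaldspurger1987, Chap. 2 II.1 (B)] -/
theorem proj_frameMp (p : LocalMp F N T' v) :
    MpPsi.proj _ (frameMp F v N P hP p) = frameSp F v N P hP (MpPsi.proj _ p) := rfl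

/-- `frameMp⁻¹` lies over `frameSp⁻¹`. [cite: MoeglinVignerasWaldspurger1987, Chap. 2 II.1 (B)] -/
theorem proj_frameMp_symm (q : LocalMp F N T v) :
    MpPsi.proj _ ((frameMp F v N P hP).symm q) = (frameSp F v N P hP).symm (MpPsi.proj _ q) := rfl

/-- **`frameOp` intertwines the Weil representations**: `ω(frameMp p) (frameOp f) = frameOp (ω(p) f)`.
[cite: MoeglinVignerasWaldspurger1987, Chap. 2 I.7] -/
theorem toRep_frameMp_apply (p : LocalMp F N T' v) (f : SchwartzBruhat (Fin N → Fv)) :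
    MpPsi.toRep (localSchrodinger F N T v) (frameMp F v N P hP p) (frameOp F v N P f) =
      frameOp F v N P (MpPsi.toRep (localSchrodinger F N T' v) p f) :=
  MpPsi.toRep_congr_apply _ _ _ _ p f

/-- the inverse direction: `ω(frameMp⁻¹ q) f = frameOp⁻¹ (ω(q) (frameOp f))`. [cite: MoeglinVignerasWaldspurger1987, Chap. 2 I.7] -/
theorem toRep_frameMp_symm_apply (q : LocalMp F N T v) (f : SchwartzBruhat (Fin N → Fv)) :
    MpPsi.toRep (localSchrodinger F N T' v) ((frameMp F v N P hP).symm q) f =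
      (frameOp F v N P).symm (MpPsi.toRep (localSchrodinger F N T v) q (frameOp F v N P f)) := by
  have h := toRep_frameMp_apply F v N P hP ((frameMp F v N P hP).symm q) f
  rw [MulEquiv.apply_symm_apply] at h
  rw [h, LinearEquiv.symm_apply_apply]

/-! ## §4 Transport of sections over `ι` -/

variable (s : UnitaryGroup.localPi E c N J v →* LocalMp F N T v)

/-- **the transported section `frameSection s := frameMp⁻¹ ∘ s ∘ frameConj : U(J')(F_v) →* S̃p(𝕎_{T'})`.**
[cite: MoeglinVignerasWaldspurger1987, Chap. 2 II Remarque (3)] -/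
def frameSection : UnitaryGroup.localPi E c N J' v →* LocalMp F N T' v :=
  ((frameMp F v N P hP).symm.toMonoidHom.comp s).comp (frameConj F E c v N hJ hJ' P hP).toMonoidHom

/-- unfolding. [cite: MoeglinVignerasWaldspurger1987, Chap. 2 II Remarque (3)] -/
theorem frameSection_apply (g' : UnitaryGroup.localPi E c N J' v) :
    frameSection F E c v N hJ hJ' P hP s g' = (frameMp F v N P hP).symm (s (frameConj F E c v N hJ hJ' P hP g')) := rfl

/-- **the Weil representation of the transported section**: `ω_{frameSection s}(g') f = frameOp⁻¹ (ω_s(P g' P⁻¹) (frameOp f))`.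
[cite: MoeglinVignerasWaldspurger1987, Chap. 2 I.7] -/
theorem toRep_frameSection_apply (g' : UnitaryGroup.localPi E c N J' v) (f : SchwartzBruhat (Fin N → Fv)) :
    (MpPsi.toRep (localSchrodinger F N T' v)).comp (frameSection F E c v N hJ hJ' P hP s) g' f =
      (frameOp F v N P).symm ((MpPsi.toRep (localSchrodinger F N T v)).comp s (frameConj F E c v N hJ hJ' P hP g') (frameOp F v N P f)) := by
  simp only [MonoidHom.comp_apply, frameSection_apply, toRep_frameMp_symm_apply F v N P hP]

/-- the same read with `frameOp` on the left: `frameOp (ω_{frameSection s}(g') f) = ω_s(P g' P⁻¹) (frameOp f)`.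
[cite: MoeglinVignerasWaldspurger1987, Chap. 2 I.7] -/
theorem frameOp_toRep_frameSection (g' : UnitaryGroup.localPi E c N J' v) (f : SchwartzBruhat (Fin N → Fv)) :
    frameOp F v N P ((MpPsi.toRep (localSchrodinger F N T' v)).comp (frameSection F E c v N hJ hJ' P hP s) g' f) =
      (MpPsi.toRep (localSchrodinger F N T v)).comp s (frameConj F E c v N hJ hJ' P hP g') (frameOp F v N P f) := by
  rw [toRep_frameSection_apply, LinearEquiv.apply_symm_apply]

/-- **smoothness transports**: if `ω_s` is smooth then so is `ω_{frameSection s}` (the stabiliser of `f` contains the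
preimage under the continuous `frameConj` of the stabiliser of `frameOp f`). [cite: MoeglinVignerasWaldspurger1987, Chap. 2 II.8] -/
theorem isSmooth_frameSection (hsm : Representation.IsSmooth ((MpPsi.toRep (localSchrodinger F N T v)).comp s)) :
    Representation.IsSmooth ((MpPsi.toRep (localSchrodinger F N T' v)).comp (frameSection F E c v N hJ hJ' P hP s)) := by
  intro f
  have hopen := hsm (frameOp F v N P f)
  rw [Representation.isSmoothVector_iff] at hopen ⊢
  have hsub : (Representation.stabilizerSubgroup ((MpPsi.toRep (localSchrodinger F N T v)).comp s) (frameOp F v N P f)).comap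
      (frameConj F E c v N hJ hJ' P hP).toMonoidHom ≤
      Representation.stabilizerSubgroup ((MpPsi.toRep (localSchrodinger F N T' v)).comp (frameSection F E c v N hJ hJ' P hP s)) f := by
    intro k hk
    rw [Subgroup.mem_comap] at hk
    change (MpPsi.toRep (localSchrodinger F N T' v)).comp (frameSection F E c v N hJ hJ' P hP s) k f = f
    apply (frameOp F v N P).injective
    rw [frameOp_toRep_frameSection]
    exact hk
  exact Subgroup.isOpen_mono hsub (hopen.preimage (frameConj F E c v N hJ hJ' P hP).continuous)

/-! ## §5 The centre is fixed: `P (z · 1) P⁻¹ = z · 1` -/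

/-- **`frameConj` fixes the centre**: `frameConj (localCenter' z) = localCenter z`. [cite: Mok2014, §1 Notation p. 5] -/
theorem frameConj_localCenter {J₁ : Matrix (Fin 1) (Fin 1) E} (hJ₁ : J₁ 0 0 ≠ 0) (z : UnitaryGroup.localPi E c 1 J₁ v) :
    frameConj F E c v N hJ hJ' P hP (UnitaryGroup.localCenter E c N J' J₁ hJ₁ v z) = UnitaryGroup.localCenter E c N J J₁ hJ₁ v z := by
  apply (UnitaryGroup.localPiEquiv E c N J v).injective
  rw [localPiEquiv_frameConj]
  refine Subtype.ext (Units.ext ?_)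
  rw [coe_frameConjLocal, Units.val_mul, Units.val_mul]
  -- both are the scalar matrix `a • 1` with `a = ((z_w)₀₀)_w`
  set a : UnitaryGroup.LocalRing E v := fun w => (((z : UnitaryGroup.LocalGLPi E 1 v) w : GL (Fin 1) (w.1.adicCompletion E)) :
    Matrix (Fin 1) (Fin 1) (w.1.adicCompletion E)) 0 0 with ha
  have hsc : ∀ (K : Matrix (Fin N) (Fin N) E),
      (UnitaryGroup.localPiEquiv E c N K v (UnitaryGroup.localCenter E c N K J₁ hJ₁ v z)).1.1 =
        a • (1 : Matrix (Fin N) (Fin N) (UnitaryGroup.LocalRing E v)) := by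
    intro K
    refine Matrix.ext fun i j => funext fun w => ?_
    rw [UnitaryGroup.coe_localPiEquiv_apply, GLn.coe_piEquiv_symm_apply, UnitaryGroup.coe_localCenter,
      UnitaryGroup.coe_localScalarGL_apply, Matrix.smul_apply, Matrix.smul_apply, ha, smul_eq_mul, smul_eq_mul, Pi.mul_apply,
      Matrix.one_apply, Matrix.one_apply]
    split_ifs <;> rfl
  rw [hsc J', hsc J, Matrix.mul_smul, Matrix.mul_one, Matrix.smul_mul, ← Units.val_mul, mul_inv_cancel, Units.val_one]

/-! ## §6 Compatibility with the embeddings `ι` (needs the quadratic coordinates) -/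

variable [Algebra.IsQuadraticExtension F E] {δ : E} (hcδ : c δ = -δ) (hδ : δ ≠ 0) {d : F} (hd : δ * δ = algebraMap F E d)
  (hT : T.IsSymm) (hT' : T'.IsSymm)

/-- **the restriction of scalars of the rational matrix `P` is `frameW`**: `resAut (P ⊗ 1) = (x, y) ↦ (P x, P y)`.
[cite: Weil1964, n° 34] -/
theorem resAut_framePloc :
    (UnitaryGroup.isQuadraticCoordinates_local E v c hcδ hδ hd).resAut (Fin N) (framePloc F E v N P) = frameW F v N P := by
  refine LinearEquiv.ext fun w => ?_
  obtain ⟨a, b⟩ := w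
  rw [(UnitaryGroup.isQuadraticCoordinates_local E v c hcδ hδ hd).resAut_apply_mk, frameW_apply, coe_framePloc,
    Matrix.map_map, Matrix.map_map]
  have hre : (UnitaryGroup.QuadraticCoordinates.re (UnitaryGroup.quadraticLocalEquiv E v c hcδ hδ).toLinearEquiv.toAddEquiv) ∘
      ((UnitaryGroup.toLocalRing E v).comp (algebraMap F Fv)) = algebraMap F Fv := by
    funext p
    exact (UnitaryGroup.isQuadraticCoordinates_local E v c hcδ hδ hd).re_map _
  have him : (UnitaryGroup.QuadraticCoordinates.im (UnitaryGroup.quadraticLocalEquiv E v c hcδ hδ).toLinearEquiv.toAddEquiv) ∘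
      ((UnitaryGroup.toLocalRing E v).comp (algebraMap F Fv)) = fun _ => 0 := by
    funext p
    exact (UnitaryGroup.isQuadraticCoordinates_local E v c hcδ hδ hd).im_map _
  rw [hre, him]
  have h0 : (P : Matrix (Fin N) (Fin N) F).map (fun _ : F => (0 : Fv)) = 0 := by ext i j; rfl
  simp only [h0, Matrix.zero_mulVec, smul_zero, add_zero, zero_add, frameLin_apply]

include hT hT' in
/-- **`ι_T (P g' P⁻¹) = frameSp (ι_{T'} g')`**: the two embeddings into the symplectic groups are conjugate along `frameW`.
[cite: MoeglinVignerasWaldspurger1987, Chap. 2 II Remarque (3)] -/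
theorem iota_frameConj (g' : UnitaryGroup.localPi E c N J' v) :
    iota F E c N hcδ hδ hd T hT hJ v (frameConj F E c v N hJ hJ' P hP g') =
      frameSp F v N P hP (iota F E c N hcδ hδ hd T' hT' hJ' v g') := by
  rw [iota_def, iota_def]
  refine Subtype.ext ?_
  change (UnitaryGroup.isQuadraticCoordinates_local E v c hcδ hδ hd).resAut (Fin N)
      ((UnitaryGroup.localPiEquiv E c N J v (frameConj F E c v N hJ hJ' P hP g') : UnitaryGroup.«local» E c N J v) :
        GL (Fin N) (UnitaryGroup.LocalRing E v)) =
    (frameW F v N P).symm ≪≫ₗ ((UnitaryGroup.isQuadraticCoordinates_local E v c hcδ hδ hd).resAut (Fin N)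
      ((UnitaryGroup.localPiEquiv E c N J' v g' : UnitaryGroup.«local» E c N J' v) : GL (Fin N) (UnitaryGroup.LocalRing E v))) ≪≫ₗ
      frameW F v N P
  rw [localPiEquiv_frameConj, coe_frameConjLocal, map_mul, map_mul, map_inv, resAut_framePloc F E c v N P hcδ hδ hd]
  refine LinearEquiv.ext fun w => ?_
  rw [LinearEquiv.mul_apply, LinearEquiv.mul_apply, LinearEquiv.trans_apply, LinearEquiv.trans_apply]
  rfl

variable (hs : ∀ g, MpPsi.proj _ (s g) = iota F E c N hcδ hδ hd T hT hJ v g)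

include hT hs in
/-- **`frameSection s` lies over `ι_{T'}`.** [cite: MoeglinVignerasWaldspurger1987, Chap. 2 II.1 (B)] -/
theorem proj_frameSection (g' : UnitaryGroup.localPi E c N J' v) :
    MpPsi.proj _ (frameSection F E c v N hJ hJ' P hP s g') = iota F E c N hcδ hδ hd T' hT' hJ' v g' := by
  rw [frameSection_apply, proj_frameMp_symm, hs, iota_frameConj F E c v N hJ hJ' P hP hcδ hδ hd hT hT', MulEquiv.symm_apply_apply]

end FrameTransport

end Literature.NumberTheory.GelbartRogawski1991.UnitaryDualPair.LocalSplitting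

end
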